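import Summits.BirchSwinnertonDyer.Rank1Residual.Additive.GordRankOneKatoCertificateClass
import Summits.BirchSwinnertonDyer.Rank1Residual.Additive.PotMultRatMainConjLowerBound
import Summits.BirchSwinnertonDyer.Rank1Residual.Additive.PotMultRatMainConjLowerBoundOdd
import Summits.BirchSwinnertonDyer.Rank1Residual.AdditivePotMult.PotMultChiBranchPrime
import Summits.BirchSwinnertonDyer.Rank1Residual.Additive.ChiBranchRatLowerDvdMultOdd
import Summits.BirchSwinnertonDyer.Rank1Residual.Additive.SemistableTwistTowerThree
import HarnessLib

/-!
# X4(M) at analytic rank ONE, EVERY odd `p` (`p = 3` included): Kato's divisibility on the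
# `ω^{(p−1)/2}`-branch of the `p`-MULTIPLICATIVE twist `E♭` + the ONE-NUMBER branch-unit certificate
# ⟹ `μ = 0 ∧ λ ≤ 1`; with Delbourgo 2002 (M): Schneider PROVED, the EXACT `ℓ`-free identity, and
# `BSD(E,p) ⟺` ONE `p`-adic valuation (cell `b2b-bsdres`, team n1011, seat p07 (gen 2), OWNERS row
# T-O7KM; the (M) twin of additive-p2 gen 19's `GordRankOneKatoCertificate{,Class,BSD}.lean` and of
# n1011-p12's `GordRankOneKatoCertificateThree.lean`)

HONEST FRAMING (cell `b2b-bsdres`, run/shared/lean/b2b/bsd-rank1-residual/, verbatim in every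
file): the goal of the cell is to DELETE the COMBINATION-SHAPED residual classes of the
Birch–Swinnerton-Dyer formula for ALL analytic-rank `≤ 1` elliptic curves over `ℚ` — "full BSD
formula for every rank `≤ 1` curve in class `C`" assembled STRICTLY from published theorems — so
that the rank-`≤ 1` remainder becomes exactly the CONSTRUCTION-SHAPED classes, which are TYPED
(missing-input `Prop`s), NOT attempted. This is not "finishing BSD". Team n1011 (RESIDUAL-MAP §I
O7: analytic rank `1` at an additive prime; here O7-ord on the (M) rows = X4(M) ∧ surj(p) ∧
`r_an = 1`, every odd `p`): research route on the CONSTRUCTION-SHAPED class O7; labels and marks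
UNCHANGED; nothing booked; NO Literature fact minted. ONE definition (a CERTIFICATE-SHAPED typed
input, nothing asserted — the (M) twin of additive-p2's `BranchUnitCertificateAt`) and theorems; named
facts enter as HYPOTHESES only: `hK` = the semistable big-image half-eigenspace reading of Kato 2004
Thm. 17.4 (3) (`Wuthrich2014.kato_halfEigenCharIdeal_dvd_cyclotomicPrime_of_surjective`, whose
reduction disjunction carries the two MULTIPLICATIVE disjuncts), `hDelM` = Delbourgo 2002 (A)+(B) in
the potentially multiplicative case (`Delbourgo2002.mainTheorem_potMult`, A190, `p ≠ 2`),
Gross–Zagier–Kolyvagin (`hGZK`), modularity (`hmod`, `hmodD`). No `_holds` of a named fact; debt 0.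

## What and why (feasibility = skel/T-O7KM.md §0)

On X4(M) (`E` additive at `p` with `ord_p j < 0`, `E[p]` irreducible) the semistable twist
`E♭ = E ⊗ χ_{p*}` is MULTIPLICATIVE at `p` (`a_p(E♭) = ±1`) and the kernel's [C]-transport
(additive-p1/p2: `SelmerDualData.exists_chiEigenInCyclotomic`, `ChiEigenSelmerInDualData.toEigen`)
makes `X(E/ℚ_∞)` an eigen-`Λ`-dual of `e_{(p−1)/2} Sel_{p^∞}(E♭/ℚ(μ_{p^∞}))`; Kato's divisibility on that
component (`hK`) is a FULL power-series identity `ι g = C(u·ϖ)·B` for some `g ∈ char_Λ X(E/ℚ_∞)`,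
`u ∈ ℤ_p^×`, `B = L_p^{±}(f, a_p, ω^{(p−1)/2}, T)` the multiplicative branch series
(`padicLFunction{Plus,Minus}BranchMult`). additive-p1 read this at `T = 0` (rank `0`); here it is read
at `T¹` exactly as additive-p2 gen 19 did on the (G)-ordinary rows:

* §0 `MultBranchUnitCertificateAt W p` (typed; nothing asserted): `ϖ·B` has constant term `0` and a
  `p`-adic UNIT as linear coefficient — ONE finite `p`-adic computation per pair.
* (§1 = the tree's full-series transport core `Additive.isTorsion_and_exists_map_eq_of_halfTail`,
  `ChiBranchRatLowerDvdMultOdd.lean` — additive-p1's core with the series kept; imported, not restated.)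
* §2 `isTorsion_and_exists_iota_eq_of_katoHalf` — the full-series brick (any semistable twist datum) from `hK`.
* §6 bridges to the rank-`0` currency: `multBranchUnitCoeffCert_of_certificate` (n1011-p06's
  `MultBranchUnitCoeffCert`, witness `n = 1`) and its odd twin — ONE certificate currency per branch
  (lead R5-18).
* §3 CLASS LEVEL, EVERY odd `p`: `ClassX4M.isTorsion_and_mu_zero_lam_le_one_of_katoHalf_of_multCert`
  (Kato + certificate ⟹ `X` torsion, `μ(fE) = 0`, `λ(fE) ≤ 1` for every cyclotomic dual datum and
  generator), hence n1011-p01's typed `CharLamLeAt W p 1` HOLDS (`ClassX4M.charLamLeAt_one_…`). The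
  image condition is the tower of `E♭` from surj(p) of `E` (n1011-p14's
  `PotMult.towerSurj_twist_of_surj`, lit-kato's proved multiplicative Lemma 20 — NO `hL20`, `p = 3`
  included).
* SEQUEL `PotMultRankOneKatoCertificateBSD.lean` (§4–§5): WITH Delbourgo 2002 (M) (`hDelM`, through
  n1011-p16's bridge `ClassX4M.delbourgo2002` — no CM automatic, `ℓ_p = 1` by
  `PotMult.reductionNonAnomalous`) and GZK: Schneider PROVED, the EXACT `ℓ`-free identity
  `ord_p #Ш(E) + ord_p Reg_p(E,Dh) + ord_p ∏c_ℓ = 1 + 2·ord_p #E(ℚ)_tors`, and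
  `BSD(E,p) ⟺ ord_p q + ord_p Reg_p(E,Dh) = 1` on the certified X4(M) ∧ surj ∧ `r_an = 1` rows.

Compared with the (G-ord) chain: NO `5 ≤ p`, NO `¬ W.HasCM`, NO `ReductionNonAnomalous`, NO `ℓ`.
What is NOT claimed: the certificate (per pair, numerical — EVIDENCE when instantiated; its
constant-term half is a theorem when `L(E,1) = 0`, not needed here); the X3♯(M) twin (Wuthrich Thm. 16
half, reducible `E[p]`; same §1 core — not this row); anything booked. Labels UNCHANGED; O7 OPEN.

References: K. Kato, Astérisque 295 (2004) Thm. 17.4 (3) [Kato2004Asterisque]; C. Wuthrich, Doc.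
Math. 19 (2014) §3, Cor. 19, Lemma 20 [Wuthrich2014]; D. Delbourgo, J. Number Theory 95 (2002) Thm.
(A), (B), p. 39 [Delbourgo2002]; R. Greenberg, LNM 1716 (1999) §5 [GreenbergLNM1716]; B. Mazur, J. Tate,
J. Teitelbaum, Invent. Math. 84 (1986) §I.10, §I.13–I.14 [MazurTateTeitelbaum1986Invent]; L.
Washington, GTM 83 (1997) §7.1 [Washington1997]; W. Stein, C. Wuthrich, Math. Comp. 82 (2013) §4
[SteinWuthrich2013]; R. L. Miller, LMS J. Comput. Math. 14 (2011) Def. 1.1 [Miller2011LMS].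
-/

noncomputable section

open scoped Classical MatrixGroups ModularForm NumberField

namespace Summit.BirchSwinnertonDyer.Rank1Residual.AdditivePotMult

open CongruenceSubgroup WeierstrassCurve NumberField Literature.NumberTheory.EllipticCurves
  Literature.NumberTheory.EllipticCurves.ModularForms
  Literature.NumberTheory.EllipticCurves.Rank1Residual
  Literature.NumberTheory.EllipticCurves.Rank1Residual.Typed
  Literature.NumberTheory.EllipticCurves.Delbourgo2002
  Literature.NumberTheory.GaloisRepresentations
  Summit.BirchSwinnertonDyer.Rank1Residual.Additive
  Summit.BirchSwinnertonDyer.Rank1Residual.X1.MuLambda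
  Summit.BirchSwinnertonDyer.Rank1Residual.X1.RankOneParitySqueeze
  IsDedekindDomain

/-! ### §0 The ONE-NUMBER certificate on the multiplicative branch (typed; nothing asserted) -/

/-- **TYPED INPUT (certificate-shaped; nothing asserted): the Néron-normalised `ω^{(p−1)/2}`-branch of
the MULTIPLICATIVE twist has `(μ_an, λ_an) = (0, 1)`.** BINDER SHAPE = n1011-p06's
`MultBranchUnitCoeffCert` / `MultOddBranchUnitCoeffCert` and census-ctyper1's `Mult[Odd]FirstUnitIndexAt`
(one currency per branch, lead R5-18), made parity-uniform as in additive-p2's `BranchUnitCertificateAt`: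
for EVERY globally minimal `V` MULTIPLICATIVE at `p` with `C • V^{(p*)} = W` (`p* = (−1)^{⌊p/2⌋} p`;
intended `V = E♭ = E ⊗ χ_{p*}`), every newform `f` of `V`, `a_p(f) = ap` (`= ±1`), and every period
ratio `ϖ` of the parity of `(p−1)/2` (`ϖ·Ω_V = Ω⁺_f` if `p ≡ 1 (mod 4)`, `ϖ·|Ω⁻_V| = Ω⁻_f` if
`p ≡ 3 (mod 4)`): the series `ϖ · L_p^{±}(f, ap, ω^{(p−1)/2}, T)` (`padicLFunctionPlusBranchMult`, resp.
`padicLFunctionMinusBranchMult`, MTT §I.10/§I.13) has constant coefficient `0` and linear coefficient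
of `p`-adic norm `1` — CONCLUSION SHAPE = additive-p2's (`c₀ = 0 ∧ ‖c₁‖ = 1`). A finite `p`-adic
computation per pair (PARI `ellpadicL(E♭, p, n, D = p*)`); a predicate on `(W, p)`. Bridges:
`multBranchUnitCoeffCert_of_certificate` / `multOddBranchUnitCoeffCert_of_certificate` (§6).
[cite: MazurTateTeitelbaum1986Invent, §I.10, §I.13–I.14 (the branch series; nothing asserted)]
[cite: SteinWuthrich2013, §4 (shape of such certificates)] -/
def MultBranchUnitCertificateAt (W : WeierstrassCurve ℚ) (p : ℕ) [Fact p.Prime] : Prop :=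
  ∀ (V : WeierstrassCurve ℚ) [V.IsElliptic] [V.IsGloballyMinimal] (C : VariableChange ℚ),
    Mult V p → C • V.quadraticTwist ((-1 : ℚ) ^ (p / 2) * p) = W →
    ∀ {N : ℕ} [NeZero N] (f : CuspForm (Gamma0 N) 2), IsNewformOf V f → ∀ (ap : ℤ), cuspCoeff f p = ap →
    ∀ ϖ : ℚ, (if Even (p / 2) then (ϖ : ℝ) * V.realPeriodRat = plusPeriod f
        else (ϖ : ℝ) * V.imaginaryPeriodRat = minusPeriod f) →
      PowerSeries.constantCoeff (PowerSeries.C (ϖ : ℚ_[p]) *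
          (if Even (p / 2) then padicLFunctionPlusBranchMult f (ap : ℚ_[p]) (p / 2)
            else padicLFunctionMinusBranchMult f (ap : ℚ_[p]) (p / 2))) = 0 ∧
      ‖PowerSeries.coeff 1 (PowerSeries.C (ϖ : ℚ_[p]) *
          (if Even (p / 2) then padicLFunctionPlusBranchMult f (ap : ℚ_[p]) (p / 2)
            else padicLFunctionMinusBranchMult f (ap : ℚ_[p]) (p / 2)))‖ = 1

/-! ### §2 The full-series brick on (M) from Kato's half-eigen divisibility -/

section Brick

variable {W : WeierstrassCurve ℚ} [W.IsElliptic] {p : ℕ} [hp : Fact p.Prime]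

/-- **Full-series brick, big image, EVERY odd `p`.** For a twist model `C • V^{(p*)} = W` (on (M):
`V = E♭` multiplicative at `p`, `PotMult.mult_of_twist_model_pStar`; the statement itself needs no
reduction hypothesis beyond the disjunction) with `ρ̄_{V,pⁿ}` onto for all `n`, a cyclotomic `κ/γ` matching the cyclotomic variable, the newform `f` of
`V`, a branch series `B` in the reduction disjunction, the period ratio `ϖ` of the parity of
`(p−1)/2`, and EVERY `Λ`-dual datum `D` of `Sel_{p^∞}(W/ℚ_∞)`: `X(W/ℚ_∞)` is torsion and SOME
`g ∈ char_Λ X(W/ℚ_∞)` has `ι g = C(u·ϖ)·B`, `u ∈ ℤ_p^×` — from the half-eigen reading of Kato 2004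
Thm. 17.4 (3) (`hK`) via the tree's full-series core `isTorsion_and_exists_map_eq_of_halfTail`. [cite: Kato2004Asterisque, Thm. 17.4 (3) (p. 273)]
[cite: Wuthrich2014, §3 (p. 390), Cor. 19 (p. 398)] [cite: GreenbergLNM1716, §5 (PDF p. 143)] -/
theorem isTorsion_and_exists_iota_eq_of_katoHalf
    (hK : Wuthrich2014.kato_halfEigenCharIdeal_dvd_cyclotomicPrime_of_surjective) (hp2 : p ≠ 2)
    (V : WeierstrassCurve ℚ) [V.IsElliptic] [V.IsGloballyMinimal] (C : VariableChange ℚ)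
    (hC : C • V.quadraticTwist ((-1 : ℚ) ^ (p / 2) * p) = W)
    (hsurjV : ∀ n : ℕ, V.HasSurjectiveModNGaloisRep (p ^ n : ℕ))
    {κ : ZpExtension ℚ p} {γ : Field.absoluteGaloisGroup ℚ}
    (hκ : κ.IsCyclotomic) (hγ : κ.IsTopGenerator γ) (hcv : IsCyclotomicVariable p γ)
    {N : ℕ} [NeZero N] {f : CuspForm (Gamma0 N) 2} (hf : IsNewformOf V f)
    (D : W.SelmerDualData κ γ) (B : PowerSeries ℚ_[p])
    (hdisj : (IsOrdinaryAt V p ∧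
        B = if Even (p / 2) then padicLFunctionBranch f ((unitRoot V p : ℤ_[p]) : ℚ_[p]) (p / 2)
          else padicLFunctionMinusBranch f ((unitRoot V p : ℤ_[p]) : ℚ_[p]) (p / 2)) ∨
      (V.HasSplitMultiplicativeReductionAtPrime p ∧
        B = if Even (p / 2) then padicLFunctionPlusBranchMult f (1 : ℚ_[p]) (p / 2)
          else padicLFunctionMinusBranchMult f (1 : ℚ_[p]) (p / 2)) ∨
      (V.HasMultiplicativeReductionAtPrime p ∧ ¬ V.HasSplitMultiplicativeReductionAtPrime p ∧
        B = if Even (p / 2) then padicLFunctionPlusBranchMult f (-1 : ℚ_[p]) (p / 2)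
          else padicLFunctionMinusBranchMult f (-1 : ℚ_[p]) (p / 2)))
    (ϖ : ℚ) (hϖ : if Even (p / 2) then (ϖ : ℝ) * V.realPeriodRat = plusPeriod f
      else (ϖ : ℝ) * V.imaginaryPeriodRat = minusPeriod f) :
    D.IsTorsion ∧ ∃ g ∈ D.charIdeal, ∃ u : ℤ_[p]ˣ,
      iwasawaToPowerSeries p g = PowerSeries.C (((u : ℤ_[p]) : ℚ_[p]) * (ϖ : ℚ_[p])) * B := by
  haveI : (V.quadraticTwist ((-1 : ℚ) ^ (p / 2) * p)).IsElliptic :=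
    isElliptic_quadraticTwist V (pStar_ne_zero p)
  refine isTorsion_and_exists_map_eq_of_halfTail hC hp2 (not_sq_eq_pStar p) rfl hκ hγ hcv D ?_
  intro K _ _ _ F _ _ _ _ γ' h2 hθ hγ' hcyc' hγ'K hγ'F D'
  exact hK p V K F B hp2 h2 hθ hdisj hsurjV hκ hγ' hcyc' hγ'K hγ'F hf D' ϖ hϖ

end Brick

/-! ### §3 Class level, EVERY odd `p`: the certificate DISCHARGES `λ ≤ 1` and `μ = 0` on X4(M) ∧ surj -/

section ClassLevel

variable {W : WeierstrassCurve ℚ} [W.IsElliptic] [W.IsGloballyMinimal] {p : ℕ} [hp : Fact p.Prime]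

omit [W.IsGloballyMinimal] in
/-- **X4(M) ∩ {`ρ̄_{E,p}` onto}, EVERY odd `p` (`p = 3` included): Kato's divisibility + the one-number
certificate ⟹ for EVERY cyclotomic dual datum and EVERY generator `fE` of `char_Λ X(E/ℚ_∞)`: `X` is
torsion, `μ(fE) = 0` and `λ(fE) ≤ 1`.** Inputs: `hK`, modular parametrisation data (`hmodD`), the
multiplicative twist model `E♭` (`ClassX4M.exists_mult_pStar_twist_model`), the tower of `E♭` from
surj(p) of `E` (`PotMult.towerSurj_twist_of_surj`; no `hL20`), §2, additive-p2's `Λ`-algebra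
(`mu_eq_zero_and_lam_le_one_of_iota_eq`). NO Delbourgo, NO height, NO GZK, NO `5 ≤ p`, NO `¬CM` here.
[cite: Kato2004Asterisque, Thm. 17.4 (3) (p. 273)] [cite: Wuthrich2014, Lemma 20 (p. 399)] [cite: Washington1997, §7.1] -/
theorem ClassX4M.isTorsion_and_mu_zero_lam_le_one_of_katoHalf_of_multCert
    (hK : Wuthrich2014.kato_halfEigenCharIdeal_dvd_cyclotomicPrime_of_surjective)
    (hmodD : nonempty_modularParametrizationData)
    (hX : ClassX4M W p) (hsurj : Surj W p) (hcert : MultBranchUnitCertificateAt W p)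
    {κ : ZpExtension ℚ p} {γ : Field.absoluteGaloisGroup ℚ}
    (hκ : κ.IsCyclotomic) (hγ : κ.IsTopGenerator γ) (hγ' : IsCyclotomicVariable p γ)
    (D : W.SelmerDualData κ γ) {fE : IwasawaAlgebra p} (hchar : D.charIdeal = Ideal.span {fE}) :
    D.IsTorsion ∧ mu fE = 0 ∧ lam fE ≤ 1 := by
  have hp2 : p ≠ 2 := hX.p_ne_two
  obtain ⟨V, iV, iVm, C, hV, hC⟩ := hX.exists_mult_pStar_twist_model
  haveI : NeZero (V.conductorNorm ℤ) := ⟨(V.conductorNorm_pos_holds).ne'⟩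
  obtain ⟨Dm⟩ := hmodD V
  obtain ⟨ϖ, hϖ⟩ := exists_periodRatio_parity (p := p) V Dm
  have hsurjV : ∀ n : ℕ, V.HasSurjectiveModNGaloisRep (p ^ n : ℕ) :=
    (ClassX4M.potMult W p hX).towerSurj_twist_of_surj hp2 hsurj V C hC
  -- the branch series of `V`'s reduction type: `a_p = 1` (split) or `a_p = −1` (non-split)
  by_cases hs : V.HasSplitMultiplicativeReductionAtPrime p
  · obtain ⟨hap, -⟩ := Dm.isNewformOf.cuspCoeff_eq_one_and_sq_of_split hs
    obtain ⟨h0, h1⟩ := hcert V C hV hC Dm.f Dm.isNewformOf 1 (by exact_mod_cast hap) ϖ hϖ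
    rw [Int.cast_one] at h0 h1
    obtain ⟨hXt, g, hg, u, hι⟩ := isTorsion_and_exists_iota_eq_of_katoHalf hK hp2 V C hC hsurjV hκ hγ
      hγ' Dm.isNewformOf D _ (Or.inr (Or.inl ⟨hs, rfl⟩)) ϖ hϖ
    exact ⟨hXt, mu_eq_zero_and_lam_le_one_of_iota_eq D hchar hg hι h0 h1⟩
  · obtain ⟨hap, -⟩ := Dm.isNewformOf.cuspCoeff_eq_neg_one_and_dvd_of_nonsplit hV hs
    obtain ⟨h0, h1⟩ := hcert V C hV hC Dm.f Dm.isNewformOf (-1) (by exact_mod_cast hap) ϖ hϖ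
    rw [Int.cast_neg, Int.cast_one] at h0 h1
    obtain ⟨hXt, g, hg, u, hι⟩ := isTorsion_and_exists_iota_eq_of_katoHalf hK hp2 V C hC hsurjV hκ hγ
      hγ' Dm.isNewformOf D _ (Or.inr (Or.inr ⟨hV, hs, rfl⟩)) ϖ hϖ
    exact ⟨hXt, mu_eq_zero_and_lam_le_one_of_iota_eq D hchar hg hι h0 h1⟩

omit [W.IsGloballyMinimal] in
/-- Hence n1011-p01's typed λ-input **`CharLamLeAt W p 1` HOLDS on X4(M) ∩ {`ρ̄` onto}, EVERY odd `p`,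
given the certificate.** [cite: Kato2004Asterisque, Thm. 17.4 (3) (p. 273)] -/
theorem ClassX4M.charLamLeAt_one_of_katoHalf_of_multCert
    (hK : Wuthrich2014.kato_halfEigenCharIdeal_dvd_cyclotomicPrime_of_surjective)
    (hmodD : nonempty_modularParametrizationData)
    (hX : ClassX4M W p) (hsurj : Surj W p) (hcert : MultBranchUnitCertificateAt W p) :
    CharLamLeAt W p 1 :=
  fun _ _ hκ hγ hγ' D _ hchar ↦
    (hX.isTorsion_and_mu_zero_lam_le_one_of_katoHalf_of_multCert hK hmodD hsurj hcert hκ hγ hγ' D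
      hchar).2.2

end ClassLevel

/-! ### §6 Bridges: ONE certificate currency per branch (lead R5-18) -/

section Bridges

variable {W : WeierstrassCurve ℚ} {p : ℕ} [hp : Fact p.Prime]

/-- **Rank-one certificate ⟹ n1011-p06's rank-zero unit-coefficient certificate, even branch**
(`p ≡ 1 (mod 4)`; witness `n = 1`): the binders are p06's verbatim (twist by `p = p*`).
[cite: MazurTateTeitelbaum1986Invent, §I.13 (nothing asserted)] -/
theorem multBranchUnitCoeffCert_of_certificate (hp4 : p % 4 = 1) (h : MultBranchUnitCertificateAt W p) :
    MultBranchUnitCoeffCert W p := by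
  intro V _ _ C hV hC N _ f hf ap hap ϖ hϖ
  have heven : Even (p / 2) := ⟨p / 4, by omega⟩
  have hC' : C • V.quadraticTwist ((-1 : ℚ) ^ (p / 2) * p) = W := by
    rw [pStar_eq_self_of_mod_four_eq_one hp4]; exact hC
  have h1 := (h V C hV hC' f hf ap hap ϖ (by rw [if_pos heven]; exact hϖ)).2
  rw [if_pos heven] at h1
  exact ⟨1, h1⟩

/-- **Rank-one certificate ⟹ n1011-p06's rank-zero unit-coefficient certificate, odd branch**
(`p ≡ 3 (mod 4)`, `p = 3` included; witness `n = 1`; twist by `−p = p*`).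
[cite: MazurTateTeitelbaum1986Invent, §I.13 (nothing asserted)] -/
theorem multOddBranchUnitCoeffCert_of_certificate (hp4 : p % 4 = 3)
    (h : MultBranchUnitCertificateAt W p) : MultOddBranchUnitCoeffCert W p := by
  intro V _ _ C hV hC N _ f hf ap hap ϖ hϖ
  have hodd : ¬ Even (p / 2) := by rw [Nat.not_even_iff_odd]; exact ⟨p / 4, by omega⟩
  have hC' : C • V.quadraticTwist ((-1 : ℚ) ^ (p / 2) * p) = W := by
    rw [pStar_eq_neg_of_mod_four_eq_three hp4]; exact hC
  have h1 := (h V C hV hC' f hf ap hap ϖ (by rw [if_neg hodd]; exact hϖ)).2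
  rw [if_neg hodd] at h1
  exact ⟨1, h1⟩

end Bridges

end Summit.BirchSwinnertonDyer.Rank1Residual.AdditivePotMult

end
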